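import Summits.CriticalPhenomena.SAWScalingLimit.Theses.SAWLoopFugacityFlow
import Summits.CriticalPhenomena.SAWScalingLimit.Theorems.SimpleSubseqLimits.Negative.SimpleSubseqLimitsCore
import Literature.Probability.RandomPlanarGeometry.SimpleCurves
import Literature.Probability.RandomPlanarGeometry.HullSubdomainPullback
import Literature.Probability.RandomPlanarGeometry.CaratheodoryHalfPlaneProofs
import Literature.Probability.RandomPlanarGeometry.RestrictionHullsProofs
import Literature.Probability.RandomPlanarGeometry.RestrictionHullsRiemannProofs
import Literature.Probability.RandomPlanarGeometry.SLEExistenceNeEightHolds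
import Literature.Probability.RandomPlanarGeometry.JordanDomainProofs

/-!
# Line `marked-point-revisit` — skeleton for the crux `SimpleSubseqLimits` (stmt-CriticalPhenomena-4982)

Crux (route decl `Summit.CriticalPhenomena.SAWScalingLimit.Theses.SAWLoopFugacityFlow.SimpleSubseqLimits`,
shared verbatim by SAWSteinDefect / SAWTensorRG / SAWFrontierHomotopy): every subsequential weak
limit `ν` of the critical `δℤ²` SAW laws in a Dobrushin domain `(D; a, b)` is carried by SIMPLE chords
from `a` to `b` in `cl D` meeting `∂D` only at `a, b`.

Idea card `Cruxes/SimpleSubseqLimits/Ideas/marked-point-revisit.md` (ideator 2; triage r1: pass ×3).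
By `Negative.simpleSubseqLimits_iff_core` (landed) only SIMPLICITY and BOUNDARY AVOIDANCE are at
stake; by `Negative/SimpleSubseqLimitsRangeBlind` no range/avoidance functional sees simplicity, so
the line splits the crux into

* SHAPE (`RangeIsArc`, stub 3): given the route's avoidance crux `AvoidanceLimit` (stmt-10649, rank 2)
  and its provable-now supports `AvoidancePassage`, `SLEAvoidanceValue`, `SLECarrier`, `ν`-a.e. the
  RANGE of the limit class is the range of a simple chord `a → b` meeting `∂D` only at `a, b`
  (two-sided fill of the range has the SLE(8/3)-trace law; a connected subset of an arc containing
  both its ends is the arc);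
* ORDER, reduced by two deterministic lemmas to ONE POINT:
  - `stub_shadowing`: a non-flat curve moving on an arc first reaches a new extreme point `η y₁` of
    the arc at a time `s` while a whole sub-arc `η [y₀, y₁)` has been visited before `s` and is
    visited again after `s`;
  - `stub_markedOfShadowing`: then for an OPEN set of parameters `(z, ρ, R)` the curve revisits,
    after the FIRST hitting time `T` of `closedBall z ρ`, the MARKED point `γ lam ∈ sphere z R`
    (`lam < T` = an entrance time into `closedBall z R` after which the curve stays there until `T`):
    a past-measurable point is hit by the future;
  - `stub_noMarkedRevisit` (limit passage: portmanteau for OPEN events along `s n`, nested `G_δ`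
    null sets, countable union over rational parameters — LEAD'S RESHAPE, cycle 1: no generic-radius
    argument is needed any more) fed by the ONE lattice input
  - `stub_onePointNoTouch` (OPNT, thickened first-approach form — LEAD'S RESHAPE, cycle 1): for every
    `z` and `0 < r < R`, `∀ θ > 0 ∃ ε > 0, R₁ < R < R₂ (r < R₁)`,
    `limsup_{δ→0⁺} P_δ[at its first r-approach of z the walk later returns ε-close to a point of its
    final approach lying in the annulus A(z; R₁, R₂)] ≤ θ` — an UNCONDITIONAL probability of an OPEN
    polyline event under `SAW.law` (= the past-AVERAGED conditional no-touch probability, by the exact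
    domain Markov property of the `x_c`-law, a proof tool, not part of the statement; hence no
    slit-domain family, no conditioning on atypical pasts, and the interior-endpoint caveat F2/S2 of
    the triage does not arise). Still implied by the summit conjecture (nested thickenings of a
    marked revisit shrink to a double point).

VOCABULARY. The predicates below (`ShadowConfig`, `MarkedConfig`, `NearRevisit`, `nearRevisitEvent`,
`latticeCurve`, `IsSubseqLimit`, `HasArcRange`, `AvoidanceAgree`, `NoMarkedRevisitFor`, `NoTouchAt`) are
VERBATIM the shared Defs file `Theorems/SAWLoopFugacityFlowMarkedPointRevisitDefs.lean` (namespace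
`…Theorems.SimpleSubseqLimits.MarkedPointRevisit`, proposed by the lead); stub files import that file,
and this skeleton switches to importing it as soon as it lands (signatures unchanged).

`crux_of_stubs` is the kernel-checked composition (sorry-free, standard axioms):
stub statements → route items → crux. `SimpleSubseqLimits_of` is the registered skeleton theorem: it
concludes the route decl BY NAME from the four A-side ROUTE ITEMS (admissible named obligations:
`AvoidanceLimit` open rank-2 crux, delegated; `AvoidancePassage`, `SLEAvoidanceValue`, `SLECarrier`
provable now, `SLECarrier` proved in `Disproof.lean` §3 `sleCarrier_holds`) and the five stubs.

SHAPE is split off the route plumbing: `AvoidanceValues` (ν and an SLE(8/3) law agree on the avoidance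
events of all inline hull subdomains) is PROVED from `AvoidanceLimit` + `AvoidancePassage` +
`SLEAvoidanceValue` (`avoidanceValues_of_routeItems`, vendored from the sibling skeleton
`past-shadowing-costs-halves`), and `stub_rangeIsArc : AvoidanceValues → SLECarrier → RangeIsArc` is
the pure topology/measure-theory statement.

Disproof.lean honoured: §2 `simpleSubseqLimits_false_without_tendsto_fst/snd` — the endpoint limits
enter through the landed `Negative.ae_source_target_range_of_weakLimitAlong` (imported; used in
`crux_of_stubs` for `γ 0 = η 0 = a`, which `stub_shadowing` needs) and through `RangeIsArc`; §4
`simple_not_isClosed` — the quantitative input is `stub_onePointNoTouch`, passed to the limit on OPEN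
events only; §5 `crux_iff_core` — endpoints are free (landed Core file imported), confinement rides on
`RangeIsArc`; §13 interior roots — OPNT is an unconditional `SAW.law` probability, no slit family; §7 range-blindness — SHAPE alone is never claimed
to give simplicity, ORDER is a separate stub; §9 criticality — OPNT is an `x_c`-statement
(`SAW.law`), false for `x > x_c` (space-filling limits revisit every marked point).
-/

noncomputable section

open MeasureTheory Filter Topology Set Metric
open Literature.Probability.RandomPlanarGeometry Literature.Probability.LatticeModels
open scoped ENNReal NNReal BoundedContinuousFunction unitInterval

namespace Summit.CriticalPhenomena.SAWScalingLimit.Cruxes.SimpleSubseqLimits.MarkedPointRevisit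

open Summit.CriticalPhenomena.SAWScalingLimit.Theses.SAWLoopFugacityFlow
  (SimpleSubseqLimits AvoidanceLimit AvoidancePassage SLEAvoidanceValue SLECarrier)

/-! ## Vocabulary (verbatim `Theorems/SAWLoopFugacityFlowMarkedPointRevisitDefs.lean`) -/

/-! ### Deterministic configurations on parametrised curves -/

/-- **Shadowing configuration** of a curve `γ` against an injective curve `η`: at time `s` the curve
`γ` sits at the arc point `η y₁` for the FIRST time; up to the later time `t` it never passes beyond
level `y₁` of the arc; and every level `y ∈ [y₀, y₁)` (a non-degenerate sub-arc) is visited both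
before `s` and again in `(s, t]` — the sub-arc `η [y₀, y₁)` is *shadowed* (idea card
`marked-point-revisit`, lemma `Shadowing`). [folklore] -/
def ShadowConfig (η γ : Curve ℂ) (s t y₀ y₁ : I) : Prop :=
  s < t ∧ y₀ < y₁ ∧ γ s = η y₁ ∧ (∀ r : I, r < s → γ r ≠ η y₁) ∧
    (∀ r : I, r ≤ t → ∃ y : I, y ≤ y₁ ∧ γ r = η y) ∧
    ∀ y : I, y₀ ≤ y → y < y₁ →
      (∃ r : I, r < s ∧ γ r = η y) ∧ (∃ r' : I, s < r' ∧ r' ≤ t ∧ γ r' = η y)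

/-- **Marked first-hit configuration** of a curve `γ` at centre `z` and radii `ρ < R`: `T` is the
FIRST hitting time of `closedBall z ρ`, and `lam < T` is an entrance time into `closedBall z R` after
which `γ` stays in that closed ball up to `T`. The MARKED POINT is `γ lam ∈ sphere z R`: a function
of the past `γ|[0,T]` only, at distance `≥ R - ρ` from the tip `γ T`. [folklore] -/
def MarkedConfig (γ : Curve ℂ) (z : ℂ) (ρ R : ℝ) (lam T : I) : Prop :=
  lam < T ∧ γ lam ∈ sphere z R ∧ (∀ u : I, lam ≤ u → u ≤ T → γ u ∈ closedBall z R) ∧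
    γ T ∈ closedBall z ρ ∧ ∀ u : I, u < T → γ u ∉ closedBall z ρ

/-- **Thickened (open) marked-revisit configuration**: times `lam < T < t'` such that at `lam` the
curve is `R₁`-far from `z`, during `[lam, T]` it stays `R₂`-close, at `T` it is `r`-close, before
`lam` it was never `r`-close (so `T` may be taken to be the first `r`-approach), and at `t'` it
returns `ε`-close to the marked point `γ lam`. All inequalities strict and the two universal clauses
range over compact parameter intervals, so the configuration is open for the sup distance and
invariant under increasing reparametrisation. Every `MarkedConfig γ z ρ R lam T` with an exact
revisit `γ t' = γ lam`, `T < t'`, is a `NearRevisit γ z r R₁ R₂ ε` for all `R₁ < R < R₂`, `ε > 0`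
and every `r ∈ (ρ, min_{u ≤ lam} dist (γ u) z)` (a nonempty interval contained in `(ρ, R]`).
[folklore] -/
def NearRevisit (γ : Curve ℂ) (z : ℂ) (r R₁ R₂ ε : ℝ) : Prop :=
  ∃ lam T t' : I, lam < T ∧ T < t' ∧ R₁ < dist (γ lam) z ∧
    (∀ u : I, lam ≤ u → u ≤ T → dist (γ u) z < R₂) ∧ dist (γ T) z < r ∧
    (∀ u : I, u ≤ lam → r < dist (γ u) z) ∧ dist (γ t') (γ lam) < ε

/-- The thickened marked-revisit EVENT on curve classes: some representative is a `NearRevisit`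
configuration (an open subset of `CurveClass ℂ`, to be proved in the limit-passage stub). [folklore] -/
def nearRevisitEvent (z : ℂ) (r R₁ R₂ ε : ℝ) : Set (CurveClass ℂ) :=
  {c | ∃ γ : Curve ℂ, CurveClass.mk γ = c ∧ NearRevisit γ z r R₁ R₂ ε}

/-- The polyline of a lattice SAW: the canonical parametrised representative of `γ.curve`
(`SimpleGraph.Walk.toCurve` through the mesh points). [folklore] -/
def latticeCurve {Ω : Set ℂ} {δ : ℝ} {u v : Site 2} (γ : SAW.DomainSAW Ω δ u v) : Curve ℂ :=
  ⟨γ.walk.toCurve (meshPoint δ)⟩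

/-- The class of the lattice polyline is the SAW's curve class (definitional). [folklore] -/
@[simp] theorem mk_latticeCurve {Ω : Set ℂ} {δ : ℝ} {u v : Site 2} (γ : SAW.DomainSAW Ω δ u v) :
    CurveClass.mk (latticeCurve γ) = γ.curve := rfl

/-! ### Limit-level and lattice-level predicates of the line -/

/-- `ν` is a **subsequential weak limit** of the pushed-forward critical `δℤ²` SAW laws of
`(D; a_δ, b_δ)` along the meshes `s n → 0⁺` — the three antecedents of the crux, verbatim. [folklore] -/
def IsSubseqLimit (D : DobrushinDomain) (a b : ℝ → Site 2) (s : ℕ → ℝ)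
    (ν : Measure (CurveClass ℂ)) : Prop :=
  Tendsto s atTop (𝓝[>] (0 : ℝ)) ∧ IsProbabilityMeasure ν ∧
    ∀ f : CurveClass ℂ →ᵇ ℝ,
      Tendsto (fun n => ∫ γ, f γ.curve ∂(SAW.law D.carrier (s n) (a (s n)) (b (s n)))) atTop
        (𝓝 (∫ x, f x ∂ν))

/-- **Arc range**: the class `c` has the RANGE of a simple chord `c'` of `(D; a, b)` lying in
`cl D` and meeting `∂D` only at `a, b` (the SHAPE clause of the line, one class at a time). [folklore] -/
def HasArcRange (D : DobrushinDomain) (c : CurveClass ℂ) : Prop :=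
  ∃ c' ∈ CurveClass.simple, c'.source = D.pt 0 ∧ c'.target = D.pt 1 ∧
    c'.range ⊆ closure D.carrier ∧ c'.range ∩ frontier D.carrier ⊆ {D.pt 0, D.pt 1} ∧
    c'.range = c.range

/-- **Hull-avoidance agreement** of two measures on curve classes: `ν` and `μ` give the same mass
to `{range ⊆ closure D'}` for every Dobrushin subdomain `D' ⊆ D` with the same marked points that
agrees with `D` in balls around them (the inline hull-subdomain condition of the route items
`AvoidanceLimit` / `AvoidancePassage` / `SLEAvoidanceValue` / `AvoidanceDeterminesLaw`). [folklore] -/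
def AvoidanceAgree (D : DobrushinDomain) (ν μ : Measure (CurveClass ℂ)) : Prop :=
  ∀ D' : DobrushinDomain, D'.carrier ⊆ D.carrier → D'.pt 0 = D.pt 0 → D'.pt 1 = D.pt 1 →
    (∃ ε : ℝ, 0 < ε ∧ D'.carrier ∩ ball (D.pt 0) ε = D.carrier ∩ ball (D.pt 0) ε ∧
      D'.carrier ∩ ball (D.pt 1) ε = D.carrier ∩ ball (D.pt 1) ε) →
    ν (CurveClass.rangeSubset (closure D'.carrier)) =
      μ (CurveClass.rangeSubset (closure D'.carrier))

/-- **No marked revisit under `ν`**: there is a DENSE set `S` of parameters `(z, ρ, R)` such that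
`ν`-a.e. class has a representative `γ` which, for every `(z, ρ, R) ∈ S` and every marked first-hit
configuration `(lam, T)`, never returns to the marked point `γ lam` after `T` (the ORDER clause of
the line at the limit level; for `ρ ≥ R` or `ρ < 0` the configuration is empty). [folklore] -/
def NoMarkedRevisitFor (ν : Measure (CurveClass ℂ)) : Prop :=
  ∃ S : Set (ℂ × ℝ × ℝ), Dense S ∧
    ∀ᵐ c ∂ν, ∃ γ : Curve ℂ, CurveClass.mk γ = c ∧
      ∀ p ∈ S, ∀ lam T : I, MarkedConfig γ p.1 p.2.1 p.2.2 lam T →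
        ∀ t' : I, T < t' → γ t' ≠ γ lam

/-- **One-point no-touch at `(D; a_δ, b_δ)`** (the line's ONE lattice input, thickened
first-approach form): for the critical SAW law `P_δ = SAW.law D δ (a δ) (b δ)`, every centre `z`,
radii `0 < r < R` and `θ > 0` there are a return radius `ε > 0` and an annulus `R₁ < R < R₂` beyond
`r` with `limsup_{δ → 0⁺} P_δ[NearRevisit (polyline) z r R₁ R₂ ε] ≤ θ` — at its first `r`-approach
of `z` the walk later comes back `ε`-close to a point of its final approach lying in `A(z; R₁, R₂)`
only with small probability. An unconditional probability of an open polyline event; an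
`x_c`-statement (false for `x > x_c`, space-filling limits); implied by the summit conjecture
(nested thickenings of a marked revisit of a weak limit shrink to a double point). [folklore] -/
def NoTouchAt (D : DobrushinDomain) (a b : ℝ → Site 2) : Prop :=
  ∀ (z : ℂ) (r R : ℝ), 0 < r → r < R → ∀ θ : ℝ≥0∞, 0 < θ →
    ∃ ε R₁ R₂ : ℝ, 0 < ε ∧ r < R₁ ∧ R₁ < R ∧ R < R₂ ∧
      limsup (fun δ : ℝ => SAW.law D.carrier δ (a δ) (b δ)
          {γ | NearRevisit (latticeCurve γ) z r R₁ R₂ ε}) (𝓝[>] (0 : ℝ)) ≤ θ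

/-! ## Registered stubs -/

/-- **Stub 1 (deterministic, M) — SHADOWING.** A non-flat curve `γ` with the range of an injective
curve `η` and the same starting point shadows a non-degenerate sub-arc: with `f := η⁻¹ ∘ γ`
(continuous, `f 0 = 0`, not monotone since `γ = η ∘ f` is not flat) pick `u < v` with `f v < f u`,
`y₁ := max_{[0,v]} f`, `s :=` the first time it is attained, `t := v`, `y₀ := f v`; two applications
of the intermediate value theorem. Tree: `Curve.IsSimple`, `Curve.IsFlat`
(`Literature/Probability/RandomPlanarGeometry/SimpleCurves.lean`). -/
theorem stub_shadowing :
    ∀ (η γ : Curve ℂ), η.IsSimple → Set.range γ = Set.range η → γ 0 = η 0 → ¬ γ.IsFlat →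
      ∃ s t y₀ y₁ : I, ShadowConfig η γ s t y₀ y₁ := by
  sorry

/-- **Stub 2 (deterministic, M) — A SHADOW REVISITS A MARKED POINT, robustly.** In a shadowing
configuration, for the OPEN NONEMPTY parameter set
`U = {(z, ρ, R) | 0 < ρ < R, dist z (η y₁) < ρ, R + dist z (η y₁) < infDist (η y₁) (η '' [0, y₀])}`:
`T :=` first hitting time of `closedBall z ρ` (`≤ s`, `> 0` as `γ 0 = η 0 ∉ closedBall z R`),
`lam := max {u ≤ T | R ≤ dist (γ u) z}` (`< T`, `γ lam ∈ sphere z R`, `γ [lam, T] ⊆ closedBall z R`);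
every point of `γ [lam, T]` is `η y` with `y ≤ y₁` (clause 5) and `y > y₀` (it is `R`-close to `z`),
and `y < y₁` at `u = lam < T ≤ s` (clause 4); clause 6 revisits `η (f lam) = γ lam` at some
`r' ∈ (s, t]`, `r' > s ≥ T`. -/
theorem stub_markedOfShadowing :
    ∀ (η γ : Curve ℂ), η.IsSimple → Set.range γ = Set.range η → γ 0 = η 0 →
      ∀ s t y₀ y₁ : I, ShadowConfig η γ s t y₀ y₁ →
        ∃ U : Set (ℂ × ℝ × ℝ), IsOpen U ∧ U.Nonempty ∧
          ∀ p ∈ U, ∃ lam T t' : I,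
            MarkedConfig γ p.1 p.2.1 p.2.2 lam T ∧ T < t' ∧ γ t' = γ lam := by
  sorry

/-- **Stub 3 (SHAPE, L) — the range is an arc (pure measure theory / plane topology; lead's
reshape: no SAW, no weak limit in the statement).** Two probability measures on curve classes, `ν`
carried by classes from `a` to `b` inside `cl D` (the crux's FREE clauses, landed
`Negative.ae_source_target_range_of_weakLimitAlong`) and `μ` carried by simple chords meeting `∂D`
only at `a, b` (the content of `SLECarrier`), which AGREE on the avoidance events of all inline hull
subdomains (`AvoidanceAgree`, delivered by `AvoidanceLimit` + `AvoidancePassage` + `SLEAvoidanceValue`: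
`avoidanceAgree_of_routeItems` below): then `ν`-a.e. class has the range of a simple chord. Plan
(triage X1/S1/F5): in the route `μ` is the SLE(8/3) law; along `s n`, `ν(range ⊆ cl D') =
μ(range ⊆ cl D')` for every hull subdomain; FIRST boundary avoidance from thin hulls shrinking to
boundary segments (`LSWConverges.tendsto_restrictionDeriv`), THEN exhaustion `{K ∩ C = ∅} =
⋃ₙ {K ⊆ cl D'ₙ}` for boundary-attached compacta (the events `{range ⊆ cl D'}` are not ∩-closed),
the Choquet capacity functional of the two-sided fill `M* = cl D ∖ (U_L ∪ U_R)` is that of the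
SLE(8/3) trace, which is a simple chord meeting `∂D` at `a, b` only; `range ⊆ M*` connected
`∋ a, b` forces `range = M*`. Planar topology + measure theory (Effros measurability of the fill). -/
theorem stub_rangeIsArc :
    ∀ (D : DobrushinDomain) (ν μ : Measure (CurveClass ℂ)), IsProbabilityMeasure ν →
      IsProbabilityMeasure μ →
      (∀ᵐ c ∂ν, c.source = D.pt 0 ∧ c.target = D.pt 1 ∧ c.range ⊆ closure D.carrier) →
      (∀ᵐ γ ∂μ, γ ∈ CurveClass.simple ∧ γ.source = D.pt 0 ∧ γ.target = D.pt 1 ∧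
        γ.range ⊆ closure D.carrier ∧ γ.range ∩ frontier D.carrier ⊆ {D.pt 0, D.pt 1}) →
      AvoidanceAgree D ν μ → ∀ᵐ c ∂ν, HasArcRange D c := by
  sorry

/-- **Stub 4 (limit passage, M; lead's reshape) — OPNT ⇒ no marked revisit under `ν`.** Take
`S = {(z, ρ, R) : z ∈ ℚ + iℚ, R ∈ ℚ}` (dense). For rational `(z, r, R)` with `0 < r < R` and
`θ_k = 1/(k+1)` choose witnesses `(ε_k, R₁ᵏ, R₂ᵏ)` from `OnePointNoTouch` and put
`E_k = {c | ∃ γ, mk γ = c ∧ NearRevisit γ z r R₁ᵏ R₂ᵏ ε_k}` — OPEN in `CurveClass ℂ` (sup-distance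
slack on compact parameter intervals + `Curve.exists_dist_reparam_lt`, exactly as
`CurveClass.isOpen_hitsBeforeApprox`; `mem_of_isOpen_of_dist_eq_zero` for representatives); by honesty
of the laws along `s n` (`Negative.eventually_isProbabilityMeasure_of_weakLimitAlong`) and the
portmanteau inequality for open sets (`ν(E_k) ≤ liminf_n P_{s n}(E_k) ≤ limsup_{δ→0⁺} P_δ(E_k) ≤ θ_k`,
the middle step because `map s atTop ≤ 𝓝[>] 0`), the `G_δ` set `N(z,r,R) = ⋂_k E_k` is `ν`-null; so
is the countable union `N` over rational `(z, r, R)`. Off `N`, ANY representative `γ` of the class has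
no exact marked revisit at any `p = (z, ρ, R) ∈ S`: a `MarkedConfig γ z ρ R lam T` with `γ t' = γ lam`,
`T < t'`, lies in `NearRevisit γ z r R₁ R₂ ε` for every `R₁ < R < R₂`, `ε > 0` and every rational
`r ∈ (ρ, m)`, `m = min_{u ≤ lam} dist (γ u) z > ρ ≥ 0` (compactness; `m ≤ R`). -/
theorem stub_noMarkedRevisit :
    ∀ (D : DobrushinDomain) (a b : ℝ → Site 2) (s : ℕ → ℝ) (ν : Measure (CurveClass ℂ)),
      NoTouchAt D a b → IsSubseqLimit D a b s ν → NoMarkedRevisitFor ν := by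
  sorry

/-- **Stub 5 (the lattice input, HARDEST, open) — ONE-POINT NO-TOUCH at `x_c`.** Tools foreseen:
exact domain Markov of the fixed-endpoint `x_c`-law at the stopping time `T` (the conditional future
is the `x_c`-SAW of the slit graph `Ω_δ ∖ ω[0,T)` from `ω_T` to `b_δ`); the marked point `ω_lam`
lies on the past, at distance `≥ R - ρ` from the tip; what is needed is only that ONE prescribed
past point is `ε`-polar for the averaged future as `δ → 0` then `ε → 0` — implied by any
Kesten/KS-type unforced-crossing bound at annuli centred at `ω_lam` (chained, KS Cor. 2.6) for
typical pasts, by Brownian domination of the future (SAWBrownianDomination.UniformDomination with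
`S = B(z, ε)`), and strictly weaker than both; trap pasts (tip pocketed with exit at `ω_lam`) must be
shown rare — the honest energy–entropy content. -/
theorem stub_onePointNoTouch :
    ∀ (D : DobrushinDomain) (a b : ℝ → Site 2), SAW.IsEndpointApprox D a b → NoTouchAt D a b := by
  sorry

/-! ## Proved: the SHAPE input from the route items
(adapted from the sibling skeleton `Lines/past-shadowing-costs-halves.lean`, §4 `avoidanceValues_of_routeItems`) -/

section RouteItems

/-- `ε`-ball agreement of `D'` with `D` at `p` keeps `p` off `closure (D ∖ D')` (the inline hull
condition of the route items implies `MarkedDomain.IsHullSubdomain`). [folklore] -/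
theorem notMem_closure_diff_of_ball_eq {D D' : DobrushinDomain} {p : ℂ} {ε : ℝ} (hε : 0 < ε)
    (h : D'.carrier ∩ ball p ε = D.carrier ∩ ball p ε) :
    p ∉ closure (D.carrier \ D'.carrier) := by
  rw [Metric.mem_closure_iff]
  push Not
  refine ⟨ε, hε, fun x hx => ?_⟩
  by_contra hlt
  push Not at hlt
  have hxball : x ∈ D.carrier ∩ ball p ε := ⟨hx.1, by rw [mem_ball, dist_comm]; exact hlt⟩
  rw [← h] at hxball
  exact hx.2 hxball.1

/-- **The route delivers `AvoidanceAgree`**: for every subsequential weak limit `ν` there is a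
chordal SLE(8/3) law `μ` of `(D; a, b)` with `AvoidanceAgree D ν μ` — `AvoidanceLimit`
(stmt-10649) gives the lattice hull-avoidance limits `Φ'_A(0)^{5/8}` for the pulled-back `*`-hulls
(chordal uniformizer by `MarkedDomain.exists_isChordalUniformizing_holds`, `IsStarHull.pullbackHull`,
restriction data by `IsStarHull.existsUnique_isRestrictionMap_holds` /
`exists_hasRestrictionDeriv_holds` — all THEOREMS), `SLEAvoidanceValue` (stmt-10651) identifies that
value as the SLE(8/3) avoidance probability (SLE law from `exists_isSLECurve_eightThirds`), and
`AvoidancePassage` (stmt-4984) sandwiches the limit `ν`. [folklore] -/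
theorem avoidanceAgree_of_routeItems (hA : AvoidanceLimit) (hP : AvoidancePassage)
    (hV : SLEAvoidanceValue) {D : DobrushinDomain} {a b : ℝ → Site 2}
    (hab : SAW.IsEndpointApprox D a b) {s : ℕ → ℝ} {ν : Measure (CurveClass ℂ)}
    (hlim : IsSubseqLimit D a b s ν) :
    ∃ μ : Measure (CurveClass ℂ), IsSLELaw ((8 : ℝ≥0) / 3) D μ ∧ AvoidanceAgree D ν μ := by
  obtain ⟨hs, hν, hw⟩ := hlim
  obtain ⟨Γ, hΓ⟩ := exists_isSLECurve_eightThirds D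
  refine ⟨_, hΓ.isSLELaw_map, fun D' hsub h0 h1 hε => ?_⟩
  refine hP D a b hab s ν _ hs hν hw hΓ.isSLELaw_map ?_ D' hsub h0 h1 hε
  intro D'' hsub'' h0'' h1'' hε''
  obtain ⟨ε, hεpos, hb0, hb1⟩ := hε''
  obtain ⟨φ, hφ⟩ := MarkedDomain.exists_isChordalUniformizing_holds D
  have hHS : D.IsHullSubdomain D'' :=
    ⟨hsub'', h0'', h1'', notMem_closure_diff_of_ball_eq hεpos hb0,
      notMem_closure_diff_of_ball_eq hεpos hb1⟩
  have hstar : IsStarHull (φ.pullbackHull D'') :=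
    IsStarHull.pullbackHull JordanDomain.isSimplyConnected_holds hφ hHS
  obtain ⟨Φ, hΦ, -⟩ := IsStarHull.existsUnique_isRestrictionMap_holds hstar
  obtain ⟨d, -, -, hd⟩ := IsStarHull.exists_hasRestrictionDeriv_holds hstar hΦ
  have hl := hA D D'' a b hab hsub'' h0'' h1'' ⟨ε, hεpos, hb0, hb1⟩ φ hφ (φ.pullbackHull D'')
    rfl Φ d hΦ hd
  have hval := hV D D'' _ hΓ.isSLELaw_map hsub'' h0'' h1'' ⟨ε, hεpos, hb0, hb1⟩ φ hφ
    (φ.pullbackHull D'') rfl Φ d hΦ hd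
  rw [hval]
  exact hl.comp hs

end RouteItems

/-! ## Composition (kernel-checked, no sorry) -/

/-- Reducible alias of the crux, used only as the result type of `crux_of_stubs` so that exactly one
theorem of this file (`SimpleSubseqLimits_of`) concludes the route decl by name for the audit. -/
abbrev Crux : Prop := SimpleSubseqLimits

/-- **The composition**: stub statements 1–5 and the four A-side route items imply the crux.
For `ν`-a.e. class `c`: the free clauses (landed `Negative.ae_source_target_range_of_weakLimitAlong`)
give `c.source = a`, `c.target = b`, `c.range ⊆ cl D`; SHAPE (stub 3, fed by `SLECarrier` and the
route's avoidance agreement `avoidanceAgree_of_routeItems`) gives an injective `η` with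
`range η = range c` from `a` to `b` meeting `∂D` only at `a, b`; ORDER (stubs 5 → 4) gives a
representative `γ` of `c` with no marked revisit on a dense parameter set `S`. If `c` were not
simple, `γ` (with `γ 0 = a ≠ b = γ 1`) would not be flat (`Curve.exists_isSimple_of_isFlat`), so
stub 1 yields a shadowing configuration and stub 2 an open set `U` of parameters with an exact
marked revisit; `U` meets `S` — contradiction. The boundary clause is transported along
`range c = range η`. -/
theorem crux_of_stubs
    (hSh : ∀ (η γ : Curve ℂ), η.IsSimple → Set.range γ = Set.range η → γ 0 = η 0 → ¬ γ.IsFlat →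
      ∃ s t y₀ y₁ : I, ShadowConfig η γ s t y₀ y₁)
    (hMk : ∀ (η γ : Curve ℂ), η.IsSimple → Set.range γ = Set.range η → γ 0 = η 0 →
      ∀ s t y₀ y₁ : I, ShadowConfig η γ s t y₀ y₁ →
        ∃ U : Set (ℂ × ℝ × ℝ), IsOpen U ∧ U.Nonempty ∧
          ∀ p ∈ U, ∃ lam T t' : I,
            MarkedConfig γ p.1 p.2.1 p.2.2 lam T ∧ T < t' ∧ γ t' = γ lam)
    (hShape : ∀ (D : DobrushinDomain) (ν μ : Measure (CurveClass ℂ)), IsProbabilityMeasure ν →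
      IsProbabilityMeasure μ →
      (∀ᵐ c ∂ν, c.source = D.pt 0 ∧ c.target = D.pt 1 ∧ c.range ⊆ closure D.carrier) →
      (∀ᵐ γ ∂μ, γ ∈ CurveClass.simple ∧ γ.source = D.pt 0 ∧ γ.target = D.pt 1 ∧
        γ.range ⊆ closure D.carrier ∧ γ.range ∩ frontier D.carrier ⊆ {D.pt 0, D.pt 1}) →
      AvoidanceAgree D ν μ → ∀ᵐ c ∂ν, HasArcRange D c)
    (hPass : ∀ (D : DobrushinDomain) (a b : ℝ → Site 2) (s : ℕ → ℝ) (ν : Measure (CurveClass ℂ)),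
      NoTouchAt D a b → IsSubseqLimit D a b s ν → NoMarkedRevisitFor ν)
    (hOP : ∀ (D : DobrushinDomain) (a b : ℝ → Site 2), SAW.IsEndpointApprox D a b → NoTouchAt D a b)
    (hA : AvoidanceLimit) (hP : AvoidancePassage) (hV : SLEAvoidanceValue) (hC : SLECarrier) :
    Crux := by
  intro D a b hab s ν hs hν hlim
  haveI := hν
  have hsub : IsSubseqLimit D a b s ν := ⟨hs, hν, hlim⟩
  have hfree :=
    Summit.CriticalPhenomena.SAWScalingLimit.Theorems.SimpleSubseqLimits.Negative.ae_source_target_range_of_weakLimitAlong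
      (ν := ν) hab hs hlim
  obtain ⟨μ, hμ, hagree⟩ := avoidanceAgree_of_routeItems hA hP hV hab hsub
  obtain ⟨hμP, hμcar⟩ := hC D μ hμ
  have hR := hShape D ν μ hν hμP hfree hμcar hagree
  obtain ⟨S, hSd, hN⟩ := hPass D a b s ν (hOP D a b hab) hsub
  filter_upwards [hR, hN, hfree] with c hc hn hf
  obtain ⟨c', hc's, h0', h1', hcl, hfr, hrange⟩ := hc
  obtain ⟨γ, hγc, hγ⟩ := hn
  obtain ⟨hsrc, htgt, -⟩ := hf
  have hsimple : c ∈ CurveClass.simple := by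
    by_contra hns
    obtain ⟨η, hη, hηc'⟩ := hc's
    have e1 : γ.source = D.pt 0 := by rw [← CurveClass.source_mk, hγc]; exact hsrc
    have e2 : η.source = D.pt 0 := by rw [← CurveClass.source_mk, hηc']; exact h0'
    have e3 : γ.target = D.pt 1 := by rw [← CurveClass.target_mk, hγc]; exact htgt
    have e4 : η.target = D.pt 1 := by rw [← CurveClass.target_mk, hηc']; exact h1'
    have hγ0 : γ 0 = η 0 := e1.trans e2.symm
    have hγ1 : γ 1 = η 1 := e3.trans e4.symm
    have hrg : Set.range γ = Set.range η := by
      have h : (CurveClass.mk γ).range = (CurveClass.mk η).range := by rw [hγc, hηc', hrange]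
      exact h
    have h01 : γ 0 ≠ γ 1 := by
      rw [hγ0, hγ1]
      exact fun h => zero_ne_one (hη h)
    have hflat : ¬ γ.IsFlat := by
      intro hfl
      obtain ⟨γ₀, hγ₀, -, hd⟩ := Curve.exists_isSimple_of_isFlat hfl h01
      apply hns
      rw [← hγc, CurveClass.mk_eq_mk_iff_dist_eq_zero.2 hd]
      exact CurveClass.mk_mem_simple hγ₀
    obtain ⟨s₀, t₀, y₀, y₁, hcfg⟩ := hSh η γ hη hrg hγ0 hflat
    obtain ⟨U, hUo, hUne, hU⟩ := hMk η γ hη hrg hγ0 s₀ t₀ y₀ y₁ hcfg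
    obtain ⟨p, hpS, hpU⟩ := hSd.exists_mem_open hUo hUne
    obtain ⟨lam, T, t', hmk, hTt, heq⟩ := hU p hpU
    exact hγ p hpS lam T hmk t' hTt heq
  exact ⟨hsimple, hsrc, htgt, hrange ▸ hcl, hrange ▸ hfr⟩

/-- **Skeleton theorem (audited by name).** The crux from the four A-side route items of
`SAWLoopFugacityFlow` — `AvoidanceLimit` (stmt-10649, the route's open rank-2 crux: this line proves
the crux RELATIVE to it, as the card and the triage record), `AvoidancePassage` (4984),
`SLEAvoidanceValue` (10651), `SLECarrier` (4985), the last three provable now — and the five stubs. -/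
theorem SimpleSubseqLimits_of (hA : AvoidanceLimit) (hP : AvoidancePassage)
    (hV : SLEAvoidanceValue) (hC : SLECarrier) : SimpleSubseqLimits :=
  crux_of_stubs stub_shadowing stub_markedOfShadowing stub_rangeIsArc stub_noMarkedRevisit
    stub_onePointNoTouch hA hP hV hC

end Summit.CriticalPhenomena.SAWScalingLimit.Cruxes.SimpleSubseqLimits.MarkedPointRevisit

end
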